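import Literature.Analysis.Complex.DbarAlongCalculus
import Literature.Analysis.Complex.PQExtDeriv
import Literature.Analysis.Pluripotential.MongeAmpereStokes
import Mathlib.Analysis.SpecialFunctions.ExpDeriv
import HarnessLib

/-!
# Hörmander's weighted identity for the `∂̄`-complex, pointwise divergence form

Layer `Literature/Analysis/Complex`. The integration-by-parts computation at the heart of the
`L²` estimates for `∂̄` (L. Hörmander, *An Introduction to Complex Analysis in Several Variables*
(1973), §4.2, (4.2.4)–(4.2.7)), in POINTWISE form and on an arbitrary complex normed space `E`
(directions `a, b ∈ E` in place of the coordinate fields `∂/∂z_j`, `∂/∂z_k`). With a real weight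
`φ` and `δ_b w = e^{φ} ∂_b (w e^{-φ}) = ∂_b w - w ∂_b φ` (4.2.4), the adjointness relations
«`∫ w₁ (∂̄_k w₂)‾ e^{-φ} = -∫ (δ_k w₁) w̄₂ e^{-φ}`» are, before integration, the exact-derivative
identities `delAlong_mul_conj_mul_weight` / `dbarAlong_mul_conj_mul_weight`; the commutation
relations (4.2.6) `δ_k ∂̄_j - ∂̄_j δ_k = ∂²φ/∂z̄_j∂z_k` are `dbarAlong_delta`; and «shifting the
differentiations to the left» gives, for a pair of functions `u, w` (two components `f_j`, `f_k` of
a `(0,1)`-form) of class `C²` near `x`, the pointwise form of (4.2.7):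

  `∂_a (u (δ_b w)‾ e^{-φ}) - ∂̄_b (u (∂̄_a w)‾ e^{-φ})`
  `  = [(δ_a u)(δ_b w)‾ - (∂̄_b u)(∂̄_a w)‾] e^{-φ} - u w̄ (∂_a ∂̄_b φ) e^{-φ}`     (at `x`)

(`HormanderL2.divergence_identity`). Integrated over a domain where the two exact derivatives
drop out (compactly supported data), summed over coordinate directions, this is
`∑ ∫ (δ_j f_j)(δ_k f_k)‾ e^{-φ} = ∑ ∫ (∂̄_k f_j)(∂̄_j f_k)‾ e^{-φ} + ∑ ∫ φ_{jk̄} f_j f̄_k e^{-φ}`,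
i.e. (4.2.7) combined with (4.2.5).

Auxiliary calculus over the tree's `delAlong` / `dbarAlong` (`∂_v`, `∂̄_v` of
`PQExtDeriv.lean` / `CauchyPompeiu.lean`): `∂_v + ∂̄_v = D(·)v`, locality and the Leibniz rule
for `∂_v` (`delAlong_mul`; for `∂̄_v` this is `Literature.Analysis.Pluripotential.dbarAlong_mul`),
conjugation (`delAlong_conj`, `dbarAlong_conj`), reality of `φ`
(`conj_delAlong_ofReal_eq_dbarAlong`), the weight `e^{-φ}` (`delAlong_ofReal_exp_neg`,
`dbarAlong_ofReal_exp_neg`), and second order at a `C²` point: `D(∂_w u)`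
(`fderiv_delAlong_apply`) and `∂̄_a ∂_b = ∂_b ∂̄_a` (`dbarAlong_delAlong_comm_of_contDiffAt`, from
the symmetry of `D²u(x)`).

Everything is proved; no definitions, no named facts.

## References

* L. Hörmander, *An Introduction to Complex Analysis in Several Variables*, 2nd ed. (1973), §4.2,
  (4.2.3)–(4.2.7). [HormanderSCV1973]

#harness_tags complex_analysis.several_variables, complex_analysis.l2_estimates, complex_geometry.riemann_existence
-/

noncomputable section

open scoped Topology ComplexConjugate ContDiff
open Set Filter Function Complex
open Literature.Analysis.Pluripotential (dbarAlong_mul)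

namespace Literature.Analysis.Complex

variable {E : Type*} [NormedAddCommGroup E] [NormedSpace ℂ E]
  {F : Type*} [NormedAddCommGroup F] [NormedSpace ℂ F]

/-! ### First-order calculus of `∂_v` -/

/-- `∂_v u + ∂̄_v u = D u (v)` (Hörmander (1973), §1.1: `du = ∂u + ∂̄u`). [cite: HormanderSCV1973, §1.1] -/
theorem delAlong_add_dbarAlong (v : E) (u : E → F) (x : E) :
    delAlong v u x + dbarAlong v u x = fderiv ℝ u x v := by
  rw [delAlong_apply, dbarAlong_apply]
  module

/-- `∂_v u = D u (v) - ∂̄_v u`. [folklore] -/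
theorem delAlong_eq_fderiv_sub_dbarAlong (v : E) (u : E → F) (x : E) :
    delAlong v u x = fderiv ℝ u x v - dbarAlong v u x :=
  eq_sub_of_add_eq (delAlong_add_dbarAlong v u x)

/-- `∂_v` is local: it only depends on the germ of the function. [folklore] -/
theorem delAlong_congr_of_eventuallyEq {u w : E → F} {x : E} (h : u =ᶠ[𝓝 x] w) (v : E) :
    delAlong v u x = delAlong v w x := by
  rw [delAlong_apply, delAlong_apply, h.fderiv_eq]

/-- **Leibniz rule** for `∂_v` on complex-valued functions (Hörmander (1973), §1.1: the product
rule for `∂/∂z_j`). [cite: HormanderSCV1973, §1.1] -/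
theorem delAlong_mul {u w : E → ℂ} {x : E} (hu : DifferentiableAt ℝ u x)
    (hw : DifferentiableAt ℝ w x) (v : E) :
    delAlong v (fun y ↦ u y * w y) x = delAlong v u x * w x + u x * delAlong v w x := by
  simp only [delAlong_apply, fderiv_fun_mul hu hw, _root_.add_apply, _root_.smul_apply,
    smul_eq_mul]
  ring

/-! ### Conjugation -/

/-- `D(ū)(x) = conj ∘ Du(x)` (no differentiability needed: `conj` is a real-linear
isomorphism). [folklore] -/
theorem fderiv_conj_comp_apply (u : E → ℂ) (x w : E) :
    fderiv ℝ (fun y ↦ conj (u y)) x w = conj (fderiv ℝ u x w) := by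
  rw [show (fun y ↦ conj (u y)) = ⇑conjCLE ∘ u from funext fun y ↦ (conjCLE_apply (u y)).symm,
    conjCLE.comp_fderiv]
  rfl

/-- `ū` is real-differentiable where `u` is. [folklore] -/
theorem differentiableAt_conj_comp {u : E → ℂ} {x : E} (hu : DifferentiableAt ℝ u x) :
    DifferentiableAt ℝ (fun y ↦ conj (u y)) x :=
  conjCLE.differentiableAt.comp x hu

/-- `∂_v ū = (∂̄_v u)‾`. [folklore] -/
theorem delAlong_conj (u : E → ℂ) (x v : E) :
    delAlong v (fun y ↦ conj (u y)) x = conj (dbarAlong v u x) := by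
  rw [delAlong_apply, dbarAlong_apply, fderiv_conj_comp_apply, fderiv_conj_comp_apply]
  simp only [smul_eq_mul, map_mul, map_add, map_inv₀, map_ofNat, conj_I]
  ring

/-- `∂̄_v ū = (∂_v u)‾`. [folklore] -/
theorem dbarAlong_conj (u : E → ℂ) (x v : E) :
    dbarAlong v (fun y ↦ conj (u y)) x = conj (delAlong v u x) := by
  rw [delAlong_apply, dbarAlong_apply, fderiv_conj_comp_apply, fderiv_conj_comp_apply]
  simp only [smul_eq_mul, map_mul, map_sub, map_inv₀, map_ofNat, conj_I]
  ring

/-- `∂̄_v (u w̄) = (∂̄_v u) w̄ + u (∂_v w)‾`. [folklore] -/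
theorem dbarAlong_mul_conj {u w : E → ℂ} {x : E} (hu : DifferentiableAt ℝ u x)
    (hw : DifferentiableAt ℝ w x) (v : E) :
    dbarAlong v (fun y ↦ u y * conj (w y)) x =
      dbarAlong v u x * conj (w x) + u x * conj (delAlong v w x) := by
  rw [dbarAlong_mul hu (differentiableAt_conj_comp hw), dbarAlong_conj]

/-- `∂_v (u w̄) = (∂_v u) w̄ + u (∂̄_v w)‾`. [folklore] -/
theorem delAlong_mul_conj {u w : E → ℂ} {x : E} (hu : DifferentiableAt ℝ u x)
    (hw : DifferentiableAt ℝ w x) (v : E) :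
    delAlong v (fun y ↦ u y * conj (w y)) x =
      delAlong v u x * conj (w x) + u x * conj (dbarAlong v w x) := by
  rw [delAlong_mul hu (differentiableAt_conj_comp hw), delAlong_conj]

/-! ### Real-valued functions and the weight `e^{-φ}` -/

/-- `D(φ : ℂ)(x) = (Dφ(x) : ℂ)` for real `φ`, unconditionally (both sides vanish where `φ` is not
differentiable). [folklore] -/
theorem fderiv_ofReal_comp_eq_comp (φ : E → ℝ) (x : E) :
    fderiv ℝ (fun y ↦ (φ y : ℂ)) x = ofRealCLM.comp (fderiv ℝ φ x) := by
  by_cases h : DifferentiableAt ℝ φ x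
  · exact (ofRealCLM.hasFDerivAt.comp x h.hasFDerivAt).fderiv
  · have h' : ¬DifferentiableAt ℝ (fun y ↦ (φ y : ℂ)) x := fun h' ↦ h <| by
      simpa [Function.comp_def] using reCLM.differentiableAt.comp x h'
    rw [fderiv_zero_of_not_differentiableAt h, fderiv_zero_of_not_differentiableAt h',
      ContinuousLinearMap.comp_zero]

/-- `D(φ : ℂ)(x)[v] = (Dφ(x)[v] : ℂ)` for real `φ`. [folklore] -/
theorem fderiv_ofReal_comp_apply (φ : E → ℝ) (x v : E) :
    fderiv ℝ (fun y ↦ (φ y : ℂ)) x v = ((fderiv ℝ φ x v : ℝ) : ℂ) := by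
  rw [fderiv_ofReal_comp_eq_comp]
  rfl

/-- For real `φ`: `(∂_v φ)‾ = ∂̄_v φ`. [folklore] -/
theorem conj_delAlong_ofReal_eq_dbarAlong (φ : E → ℝ) (x v : E) :
    conj (delAlong v (fun y ↦ (φ y : ℂ)) x) = dbarAlong v (fun y ↦ (φ y : ℂ)) x := by
  rw [delAlong_apply, dbarAlong_apply, fderiv_ofReal_comp_apply, fderiv_ofReal_comp_apply]
  simp only [smul_eq_mul, map_mul, map_sub, map_inv₀, map_ofNat, conj_I, conj_ofReal]
  ring

/-- For real `φ`: `(∂̄_v φ)‾ = ∂_v φ`. [folklore] -/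
theorem conj_dbarAlong_ofReal_eq_delAlong (φ : E → ℝ) (x v : E) :
    conj (dbarAlong v (fun y ↦ (φ y : ℂ)) x) = delAlong v (fun y ↦ (φ y : ℂ)) x := by
  rw [← conj_delAlong_ofReal_eq_dbarAlong, conj_conj]

/-- For real `φ`: `(∂̄_a ∂_b φ)‾ = ∂_a ∂̄_b φ` (the Levi form is Hermitian). [folklore] -/
theorem conj_dbarAlong_delAlong_ofReal (φ : E → ℝ) (x a b : E) :
    conj (dbarAlong a (delAlong b (fun y ↦ (φ y : ℂ))) x) =
      delAlong a (dbarAlong b (fun y ↦ (φ y : ℂ))) x := by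
  rw [← delAlong_conj]
  congr 1
  funext y
  exact conj_delAlong_ofReal_eq_dbarAlong φ y b

/-- `∂_v e^{-φ} = -(∂_v φ) e^{-φ}` for real `φ` differentiable at `x`. [folklore] -/
theorem delAlong_ofReal_exp_neg {φ : E → ℝ} {x : E} (hφ : DifferentiableAt ℝ φ x) (v : E) :
    delAlong v (fun y ↦ ((Real.exp (-φ y) : ℝ) : ℂ)) x =
      -delAlong v (fun y ↦ (φ y : ℂ)) x * (Real.exp (-φ x) : ℂ) := by
  have hd : ∀ w, fderiv ℝ (fun y ↦ Real.exp (-φ y)) x w = Real.exp (-φ x) * -fderiv ℝ φ x w := by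
    intro w
    rw [fderiv_exp (f := fun y ↦ -φ y) hφ.fun_neg, fderiv_fun_neg]
    simp [smul_eq_mul]
  rw [delAlong_apply, delAlong_apply, fderiv_ofReal_comp_apply (fun y ↦ Real.exp (-φ y)),
    fderiv_ofReal_comp_apply (fun y ↦ Real.exp (-φ y)), fderiv_ofReal_comp_apply,
    fderiv_ofReal_comp_apply, hd, hd]
  push_cast
  simp only [smul_eq_mul]
  ring

/-- `∂̄_v e^{-φ} = -(∂̄_v φ) e^{-φ}` for real `φ` differentiable at `x`. [folklore] -/
theorem dbarAlong_ofReal_exp_neg {φ : E → ℝ} {x : E} (hφ : DifferentiableAt ℝ φ x) (v : E) :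
    dbarAlong v (fun y ↦ ((Real.exp (-φ y) : ℝ) : ℂ)) x =
      -dbarAlong v (fun y ↦ (φ y : ℂ)) x * (Real.exp (-φ x) : ℂ) := by
  have hd : ∀ w, fderiv ℝ (fun y ↦ Real.exp (-φ y)) x w = Real.exp (-φ x) * -fderiv ℝ φ x w := by
    intro w
    rw [fderiv_exp (f := fun y ↦ -φ y) hφ.fun_neg, fderiv_fun_neg]
    simp [smul_eq_mul]
  rw [dbarAlong_apply, dbarAlong_apply, fderiv_ofReal_comp_apply (fun y ↦ Real.exp (-φ y)),
    fderiv_ofReal_comp_apply (fun y ↦ Real.exp (-φ y)), fderiv_ofReal_comp_apply,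
    fderiv_ofReal_comp_apply, hd, hd]
  push_cast
  simp only [smul_eq_mul]
  ring

/-! ### Second order at a `C²` point -/

section SecondOrder

variable {u : E → F} {x : E} {n : WithTop ℕ∞}

/-- `Du` is differentiable at a `C²` point. [folklore] -/
theorem differentiableAt_fderiv_of_contDiffAt (hu : ContDiffAt ℝ n u x) (hn : 2 ≤ n) :
    DifferentiableAt ℝ (fderiv ℝ u) x :=
  (hu.fderiv_right (m := 1) (by simpa [one_add_one_eq_two] using hn)).differentiableAt
    one_ne_zero

/-- `∂̄_w u` is differentiable at a `C²` point of `u`. [folklore] -/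
theorem differentiableAt_dbarAlong_of_contDiffAt (hu : ContDiffAt ℝ n u x) (hn : 2 ≤ n)
    (w : E) : DifferentiableAt ℝ (dbarAlong w u) x := by
  have hd := differentiableAt_fderiv_of_contDiffAt hu hn
  unfold dbarAlong
  exact ((hd.clm_apply (differentiableAt_const _)).add
    ((hd.clm_apply (differentiableAt_const _)).const_smul I)).const_smul _

/-- `∂_w u` is differentiable at a `C²` point of `u`. [folklore] -/
theorem differentiableAt_delAlong_of_contDiffAt (hu : ContDiffAt ℝ n u x) (hn : 2 ≤ n)
    (w : E) : DifferentiableAt ℝ (delAlong w u) x := by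
  have hd := differentiableAt_fderiv_of_contDiffAt hu hn
  unfold delAlong
  exact ((hd.clm_apply (differentiableAt_const _)).sub
    ((hd.clm_apply (differentiableAt_const _)).const_smul I)).const_smul _

/-- The derivative of `∂_w u` in terms of the second derivative of `u`:
`D(∂_w u)(x)[v] = ½ (D²u(x)[v][w] - i D²u(x)[v][iw])`. [folklore] -/
theorem fderiv_delAlong_apply (hu : ContDiffAt ℝ n u x) (hn : 2 ≤ n) (v w : E) :
    fderiv ℝ (delAlong w u) x v = (2 : ℂ)⁻¹ • (fderiv ℝ (fderiv ℝ u) x v w -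
      I • fderiv ℝ (fderiv ℝ u) x v (I • w)) := by
  have hd : DifferentiableAt ℝ (fderiv ℝ u) x := differentiableAt_fderiv_of_contDiffAt hu hn
  have h1 : ∀ w' : E, HasFDerivAt (fun y ↦ fderiv ℝ u y w')
      ((fderiv ℝ (fderiv ℝ u) x).flip w') x := fun w' ↦ by
    simpa using hd.hasFDerivAt.clm_apply (hasFDerivAt_const w' x)
  have h2 : HasFDerivAt (delAlong w u) ((2 : ℂ)⁻¹ • ((fderiv ℝ (fderiv ℝ u) x).flip w -
      I • (fderiv ℝ (fderiv ℝ u) x).flip (I • w))) x := by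
    unfold delAlong
    exact ((h1 w).sub ((h1 (I • w)).const_smul I)).const_smul (2 : ℂ)⁻¹
  rw [h2.fderiv]
  simp

/-- **`∂̄_a` and `∂_b` commute at a `C²` point**: `∂̄_a (∂_b u)(x) = ∂_b (∂̄_a u)(x)`
(Hörmander (1973), §2.1, `∂²/∂z̄_j∂z_k = ∂²/∂z_k∂z̄_j`), from the symmetry of `D²u(x)`.
[cite: HormanderSCV1973, §2.1] -/
theorem dbarAlong_delAlong_comm_of_contDiffAt (hu : ContDiffAt ℝ n u x) (hn : 2 ≤ n)
    (a b : E) : dbarAlong a (delAlong b u) x = delAlong b (dbarAlong a u) x := by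
  have hs : IsSymmSndFDerivAt ℝ u x := hu.isSymmSndFDerivAt (by simpa using hn)
  rw [dbarAlong_apply, delAlong_apply, fderiv_delAlong_apply hu hn, fderiv_delAlong_apply hu hn,
    fderiv_dbarAlong_apply hu hn, fderiv_dbarAlong_apply hu hn, hs b a, hs b (I • a),
    hs (I • b) a, hs (I • b) (I • a)]
  module

end SecondOrder

/-! ### Hörmander's identities -/

namespace HormanderL2

variable {u w : E → ℂ} {φ : E → ℝ} {x : E} {n : WithTop ℕ∞}

/-- **Adjointness of `δ_a` and `-∂̄_a`, pointwise** (Hörmander (1973), §4.2, the display after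
(4.2.4): `∫ w₁ (∂̄_k w₂)‾ e^{-φ} = -∫ (δ_k w₁) w̄₂ e^{-φ}` for test functions): with
`δ_a u = ∂_a u - u ∂_a φ`,
`∂_a (u w̄ e^{-φ}) = (δ_a u) w̄ e^{-φ} + u (∂̄_a w)‾ e^{-φ}` at every point where `u, w, φ` are
differentiable. [cite: HormanderSCV1973, §4.2 (4.2.4)] -/
theorem delAlong_mul_conj_mul_weight (hu : DifferentiableAt ℝ u x) (hw : DifferentiableAt ℝ w x)
    (hφ : DifferentiableAt ℝ φ x) (a : E) :
    delAlong a (fun y ↦ u y * conj (w y) * (Real.exp (-φ y) : ℂ)) x =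
      (delAlong a u x - u x * delAlong a (fun y ↦ (φ y : ℂ)) x) * conj (w x) *
          (Real.exp (-φ x) : ℂ) +
        u x * conj (dbarAlong a w x) * (Real.exp (-φ x) : ℂ) := by
  have hε : DifferentiableAt ℝ (fun y ↦ ((Real.exp (-φ y) : ℝ) : ℂ)) x :=
    ofRealCLM.differentiableAt.comp x hφ.fun_neg.exp
  rw [delAlong_mul (hu.fun_mul (differentiableAt_conj_comp hw)) hε, delAlong_mul_conj hu hw,
    delAlong_ofReal_exp_neg hφ]
  ring

/-- **Adjointness of `∂̄_b` and `-δ_b`, pointwise** (same display, conjugated):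
`∂̄_b (u w̄ e^{-φ}) = (∂̄_b u) w̄ e^{-φ} + u (δ_b w)‾ e^{-φ}` with `δ_b w = ∂_b w - w ∂_b φ`, at
every point where `u, w, φ` are differentiable. [cite: HormanderSCV1973, §4.2 (4.2.4)] -/
theorem dbarAlong_mul_conj_mul_weight (hu : DifferentiableAt ℝ u x) (hw : DifferentiableAt ℝ w x)
    (hφ : DifferentiableAt ℝ φ x) (b : E) :
    dbarAlong b (fun y ↦ u y * conj (w y) * (Real.exp (-φ y) : ℂ)) x =
      dbarAlong b u x * conj (w x) * (Real.exp (-φ x) : ℂ) +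
        u x * conj (delAlong b w x - w x * delAlong b (fun y ↦ (φ y : ℂ)) x) *
          (Real.exp (-φ x) : ℂ) := by
  have hε : DifferentiableAt ℝ (fun y ↦ ((Real.exp (-φ y) : ℝ) : ℂ)) x :=
    ofRealCLM.differentiableAt.comp x hφ.fun_neg.exp
  rw [dbarAlong_mul (hu.fun_mul (differentiableAt_conj_comp hw)) hε, dbarAlong_mul_conj hu hw,
    dbarAlong_ofReal_exp_neg hφ, map_sub, map_mul, conj_delAlong_ofReal_eq_dbarAlong]
  ring

/-- **The commutation relation (4.2.6), pointwise**: for `w, φ` of class `C²` at `x` and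
`δ_b w = ∂_b w - w ∂_b φ`,
`∂̄_a (δ_b w)(x) = δ_b (∂̄_a w)(x) - w(x) (∂̄_a ∂_b φ)(x)`, i.e.
`δ_b ∂̄_a - ∂̄_a δ_b = φ_{b ā}` (Hörmander (1973), (4.2.6)). [cite: HormanderSCV1973, §4.2 (4.2.6)] -/
theorem dbarAlong_delta (hw : ContDiffAt ℝ n w x) (hφ : ContDiffAt ℝ n φ x) (hn : 2 ≤ n)
    (a b : E) :
    dbarAlong a (fun y ↦ delAlong b w y - w y * delAlong b (fun z ↦ (φ z : ℂ)) y) x =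
      delAlong b (dbarAlong a w) x - dbarAlong a w x * delAlong b (fun z ↦ (φ z : ℂ)) x -
        w x * dbarAlong a (delAlong b (fun z ↦ (φ z : ℂ))) x := by
  have hn0 : n ≠ 0 := (one_pos.trans_le (one_le_two.trans hn)).ne'
  have hΦ : ContDiffAt ℝ n (fun z ↦ (φ z : ℂ)) x := hφ.continuousLinearMap_comp ofRealCLM
  rw [dbarAlong_sub (differentiableAt_delAlong_of_contDiffAt hw hn b)
      ((hw.differentiableAt hn0).fun_mul (differentiableAt_delAlong_of_contDiffAt hΦ hn b)),
    dbarAlong_mul (hw.differentiableAt hn0) (differentiableAt_delAlong_of_contDiffAt hΦ hn b),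
    dbarAlong_delAlong_comm_of_contDiffAt hw hn]
  ring

/-- **Hörmander's weighted identity, pointwise divergence form** (the computation proving
(4.2.7) from (4.2.5), Hörmander (1973), §4.2, p. 83, before integration). For `u, w : E → ℂ` and a
real weight `φ` of class `C²` at `x`, directions `a, b ∈ E`, `δ_b w = ∂_b w - w ∂_b φ`:

  `∂_a (u (δ_b w)‾ e^{-φ})(x) - ∂̄_b (u (∂̄_a w)‾ e^{-φ})(x)`
  `  = [(δ_a u)(δ_b w)‾ - (∂̄_b u)(∂̄_a w)‾](x) e^{-φ(x)} - u w̄ (∂_a ∂̄_b φ)(x) e^{-φ(x)}`.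

With `u = f_j`, `w = f_k`, `a = e_j`, `b = e_k`, summed over `j, k` and integrated (the left side
integrates to zero for compactly supported `f`), this is
`∑ ∫ (δ_j f_j)(δ_k f_k)‾ e^{-φ} - ∑ ∫ (∂̄_k f_j)(∂̄_j f_k)‾ e^{-φ} = ∑ ∫ φ_{jk̄} f_j f̄_k e^{-φ}`,
i.e. (4.2.5) turned into (4.2.7). [cite: HormanderSCV1973, §4.2 (4.2.5)–(4.2.7)] -/
theorem divergence_identity (hu : ContDiffAt ℝ n u x) (hw : ContDiffAt ℝ n w x)
    (hφ : ContDiffAt ℝ n φ x) (hn : 2 ≤ n) (a b : E) :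
    delAlong a (fun y ↦ u y * conj (delAlong b w y - w y * delAlong b (fun z ↦ (φ z : ℂ)) y) *
        (Real.exp (-φ y) : ℂ)) x -
      dbarAlong b (fun y ↦ u y * conj (dbarAlong a w y) * (Real.exp (-φ y) : ℂ)) x =
    ((delAlong a u x - u x * delAlong a (fun z ↦ (φ z : ℂ)) x) *
          conj (delAlong b w x - w x * delAlong b (fun z ↦ (φ z : ℂ)) x) -
        dbarAlong b u x * conj (dbarAlong a w x)) * (Real.exp (-φ x) : ℂ) -
      u x * conj (w x) * delAlong a (dbarAlong b (fun z ↦ (φ z : ℂ))) x *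
        (Real.exp (-φ x) : ℂ) := by
  have hn0 : n ≠ 0 := (one_pos.trans_le (one_le_two.trans hn)).ne'
  have hΦ : ContDiffAt ℝ n (fun z ↦ (φ z : ℂ)) x := hφ.continuousLinearMap_comp ofRealCLM
  have hud : DifferentiableAt ℝ u x := hu.differentiableAt hn0
  have hwd : DifferentiableAt ℝ w x := hw.differentiableAt hn0
  have hφd : DifferentiableAt ℝ φ x := hφ.differentiableAt hn0
  have hδ : DifferentiableAt ℝ
      (fun y ↦ delAlong b w y - w y * delAlong b (fun z ↦ (φ z : ℂ)) y) x :=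
    (differentiableAt_delAlong_of_contDiffAt hw hn b).fun_sub
      (hwd.fun_mul (differentiableAt_delAlong_of_contDiffAt hΦ hn b))
  rw [delAlong_mul_conj_mul_weight hud hδ hφd,
    dbarAlong_mul_conj_mul_weight hud (differentiableAt_dbarAlong_of_contDiffAt hw hn a) hφd,
    dbarAlong_delta hw hφ hn]
  simp only [map_sub, map_mul, conj_dbarAlong_delAlong_ofReal, conj_delAlong_ofReal_eq_dbarAlong]
  ring

end HormanderL2

end Literature.Analysis.Complex
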